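import Literature.Barriers.NavierStokesRegularity.NavierStokesInequalityProfilesProofs
import Literature.Barriers.NavierStokesRegularity.NavierStokesInequalitySingularSolutionHolds
import Literature.Barriers.NavierStokesRegularity.NavierStokesInequalitySingularSolutionsProofs
import HarnessLib

/-!
# Discharge of the named fact `exists_isNSIBlock`

Topic `Literature/Barriers/NavierStokesRegularity`; proofs-only file (no definitions, no new named
facts). The named fact
`Literature.Barriers.NavierStokesRegularity.exists_isNSIBlock`
(`NavierStokesInequalitySingularSolutionsProofs.lean:180`)
is closed by ONE TERM from results already in the tree: the accepted reduction
`Literature.Barriers.NavierStokesRegularity.exists_isNSIBlock_of_arrangement`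
(`NavierStokesInequalitySingularSolutionsProofs.lean:192`)
applied to the accepted unconditional discharges `NSIArrangementExists_holds`,
`NSIBlock_of_arrangement_holds` of its hypotheses.
Found by the librarian's forward-chaining census (sweep g29, 2026-08-16): the reduction and the
last of its inputs landed in
different units, so nobody had written the closing line.
-/

namespace Literature.Barriers.NavierStokesRegularity

/-- **`exists_isNSIBlock` holds**: the reduction `exists_isNSIBlock_of_arrangement` applied to
`NSIArrangementExists_holds`, `NSIBlock_of_arrangement_holds`. [folklore] -/
theorem exists_isNSIBlock_holds : exists_isNSIBlock :=
  _root_.Literature.Barriers.NavierStokesRegularity.exists_isNSIBlock_of_arrangement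
    _root_.Literature.Barriers.NavierStokesRegularity.NSIArrangementExists_holds
    _root_.Literature.Barriers.NavierStokesRegularity.NSIBlock_of_arrangement_holds

end Literature.Barriers.NavierStokesRegularity
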